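import Summits.Langlands.Langlands.Theorems.HalfIntegralTwistCM.Negative.WithoutIsCMField
import HarnessLib

/-!
# `HalfIntegralTwistCM` (stmt-Langlands-14036) — negative knowledge V: hypotheses (iii) and (iv) are
# load-bearing

Sorry-free (cdisprove cycle 1). (iii) `(s₁-s₂) ι + (s₁-s₂) ῑ ∈ 2ℤ`: the crux without it is FALSE over
every CM field with two complex places, MODULO Weil's unit criterion
(`Patrikis2019_heckeCharacter_archType_iff_units`), concretely over `ℚ(ζ₅)`
(`halfIntegralTwistCM_false_without_parity`; witness `ψ_{w₁} = z/|z|`, `ψ_{w₂} = 1`, exponents of mixed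
parity; unit condition `unitCondition_angular_of_isCMField` from Mathlib's
`IsCMField.unitsMulComplexConjInv`). (iv) the datum `ω`: the crux without it is FALSE UNCONDITIONALLY
over `ℚ(ζ₅)` (`halfIntegralTwistCM_false_without_datum`; `s₁ = s₂ = (1/4)𝟙_{w₁}`). Both by the
parallelism of real parts of archimedean exponents (`exists_re_archParam_parallel_glOne`, file
`ModulusParallel`). The honest form of (iii) is "uniform parity across the complex places". Finally the hypotheses
(i)–(iv) are jointly satisfiable over `ℚ(ζ₅)` (`hypotheses_satisfiable`): the crux is not vacuous.
[folklore]
-/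

noncomputable section

open scoped MatrixGroups Matrix Classical NumberField ComplexConjugate
open NumberField NumberField.InfinitePlace NumberField.mixedEmbedding IsDedekindDomain

namespace Summit.Langlands.Langlands.Theorems.HalfIntegralTwistCM.Negative

open Literature.NumberTheory.Automorphic
open Literature.NumberTheory.GaloisRepresentations

variable {K : Type} [Field K] [NumberField K] {hcpt : isCompact_glFiniteIntegralLevel 1 K}

/-! ## Load-bearing analysis III: hypothesis (iii) (uniform parity) cannot be dropped
## (kernel-checked modulo Weil; witness `ℚ(ζ₅)`, mixed parity at its two complex places)

With (iii) `(s₁-s₂) ι + (s₁-s₂) ῑ ∈ 2ℤ` DROPPED the crux is FALSE over every CM field with two distinct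
complex places (so `[K:ℚ] ≥ 4`; over an imaginary quadratic field it stays true, F3(b)/(d)). Witness:
`ψ` the Hecke character with `ψ_{w₁}(z) = z/|z|`, `ψ_w = 1` at the other infinite places (Weil:
`(ι(u)/|ι(u)|)² = ι(u ū⁻¹)` is a root of unity for every unit `u` of a CM field — Mathlib
`IsCMField.unitsMulComplexConjInv`), `ω = π_ψ` with exponents `e = (1/2, -1/2)` at `(σ_{w₁}, σ̄_{w₁})` and
`0` elsewhere (`archParam_of_hasUnitaryArchType`), `d = (1/4)·𝟙_{mk ι = w₁}`, `s₁ = e + d`, `s₂ = -d`: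
(i) holds with `k = s₁ - s₂ = (1, 0 ; 0, 0)` — parity ODD at `w₁`, EVEN at `w₂` —, (ii) holds
(`d ι = d ῑ`, `e ι - e ῑ ∈ ℤ`), (iv) holds (`s₁ + s₂ = e`), and a re-twist `χ` would have
`Re (p σ_{w₁} + p σ̄_{w₁}) ∈ 1/2 + ℤ` but `Re (p σ_{w₂} + p σ̄_{w₂}) ∈ ℤ`, contradicting the parallelism of
real parts (`exists_re_archParam_parallel_glOne`). So the honest hypothesis is "the parity of
`(s₁-s₂) ι + (s₁-s₂) ῑ` is the SAME at all complex places"; (iii) as typed (all even) is one of its two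
cases, uniform odd parity being equally fine on paper. -/

/-- **Weil's unit condition for an angular type over a CM field.** For `K` CM, `m = 𝟙_{w₁}` (angular
degree `1` at one infinite place, `0` elsewhere) and `t = 0`: `(ι_{w₁}(u)/|ι_{w₁}(u)|)^{2N} = 1` for every
unit `u`, `N = |μ(K)|`, because `(ι(u)/|ι(u)|)² = ι(u ū⁻¹)` and `u ū⁻¹` is a root of unity
(Mathlib `NumberField.IsCMField.unitsMulComplexConjInv`). [folklore] -/
theorem unitCondition_angular_of_isCMField (K : Type) [Field K] [NumberField K] [NumberField.IsCMField K]
    (w₁ : InfinitePlace K) :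
    ∃ M : ℕ, 0 < M ∧ ∀ α : (𝓞 K)ˣ,
      (∏ w : InfinitePlace K, archUnitaryValue ((fun w => if w = w₁ then (1 : ℤ) else 0) w)
        ((fun _ => (0 : ℝ)) w) (w.embedding ((α : 𝓞 K) : K))) ^ M = 1 := by
  classical
  refine ⟨2 * Nat.card (NumberField.Units.torsion K), Nat.mul_pos two_pos Nat.card_pos, fun α => ?_⟩
  -- only the factor at `w₁` is non-trivial
  have h0 : ∀ z : ℂ, archUnitaryValue 0 0 z = 1 := fun z => by simp [archUnitaryValue]
  beta_reduce
  rw [Finset.prod_eq_single w₁ (fun w _ hw => by rw [if_neg hw, h0])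
    (fun h => absurd (Finset.mem_univ _) h), if_pos rfl]
  set a : K := ((α : 𝓞 K) : K) with ha
  set φ : K →+* ℂ := w₁.embedding with hφ
  have ha0 : a ≠ 0 := by
    rw [ha]; exact_mod_cast α.ne_zero
  have hφa : φ a ≠ 0 := (map_ne_zero φ).2 ha0
  -- `(φ a/|φ a|)² = φ (a ā⁻¹)`
  have hsq : (φ a / (‖φ a‖ : ℂ)) ^ 2 = φ (a * (NumberField.IsCMField.complexConj K a)⁻¹) := by
    have hnorm : ((‖φ a‖ : ℂ)) ^ 2 = φ a * conj (φ a) := by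
      rw [Complex.mul_conj, Complex.normSq_eq_norm_sq]; push_cast; ring
    have hconj : conj (φ a) ≠ 0 := by
      rwa [Ne, map_eq_zero]
    rw [div_pow, hnorm, map_mul, map_inv₀, NumberField.IsCMField.complexEmbedding_complexConj]
    field_simp
  -- `a ā⁻¹` is the root of unity `unitsMulComplexConjInv α`
  set ζ := NumberField.IsCMField.unitsMulComplexConjInv K α with hζ
  have hζval : (((ζ : (𝓞 K)ˣ) : 𝓞 K) : K) = a * (NumberField.IsCMField.complexConj K a)⁻¹ := by
    simp [hζ, NumberField.IsCMField.unitsMulComplexConjInv_apply, ha, Units.coe_mapEquiv,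
      NumberField.RingOfIntegers.mapRingEquiv_apply]
  have hζN : (ζ : (𝓞 K)ˣ) ^ Nat.card (NumberField.Units.torsion K) = 1 := by
    have := pow_card_eq_one' (G := NumberField.Units.torsion K) (x := ζ)
    exact_mod_cast congrArg Subtype.val this
  have hζN' : (a * (NumberField.IsCMField.complexConj K a)⁻¹) ^ Nat.card (NumberField.Units.torsion K)
      = 1 := by
    rw [← hζval]
    have := congrArg (fun u : (𝓞 K)ˣ => (((u : 𝓞 K)) : K)) hζN
    simpa using this
  unfold archUnitaryValue
  rw [zpow_one, Complex.ofReal_zero, zero_mul, Complex.cpow_zero, mul_one, pow_mul, hsq, ← map_pow,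
    hζN', map_one]

/-- **Hypothesis (iii) is load-bearing over every CM field with two complex places** (modulo Weil's
unit criterion): mixed parity — odd at `w₁`, even at `w₂` — kills the half-integral re-twist, by the
parallelism of the real parts of the exponents of the putative `χ`. [cite: Patrikis2019, Lemma 2.1.1] -/
theorem halfIntegralTwistCM_false_without_parity_of_two_complex_places
    (hW : Patrikis2019_heckeCharacter_archType_iff_units)
    {K : Type} [Field K] [NumberField K] [hK : NumberField.IsCMField K]
    (w₁ w₂ : {w : InfinitePlace K // w.IsComplex}) (hne : w₁ ≠ w₂) : ¬ (∀ (K : Type) [Field K] [NumberField K], NumberField.IsCMField K →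
        ∀ (h1 : Literature.NumberTheory.Automorphic.isCompact_glFiniteIntegralLevel 1 K)
          (s₁ s₂ : (K →+* ℂ) → ℂ), (∀ ι, ∃ k : ℤ, s₁ ι - s₂ ι = k) →
          (∀ ι, ∃ m : ℤ, s₁ ι - s₁ (NumberField.ComplexEmbedding.conjugate ι) = m) →
          (∃ ω : Literature.NumberTheory.Automorphic.CuspidalAutomorphicRepData 1 K h1,
            ω.1.HasArchParameter (fun ι => {s₁ ι + s₂ ι})) →
          ∃ (χ : Literature.NumberTheory.Automorphic.CuspidalAutomorphicRepData 1 K h1)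
            (p : (K →+* ℂ) → ℂ), χ.1.HasArchParameter (fun ι => {p ι}) ∧
              ∀ ι, ∃ m : ℤ, p ι + s₁ ι - 1 / 2 = m) := by
  intro hC
  classical
  -- the Hecke character `ψ` with `ψ_{w₁} = z/|z|`, `ψ_w = 1` elsewhere (Weil)
  obtain ⟨ψ, -, hψ⟩ := (hW K (fun w => if w = w₁.1 then 1 else 0) (fun _ => 0)).2
    (unitCondition_angular_of_isCMField K w₁.1)
  set h1 : isCompact_glFiniteIntegralLevel 1 K := isCompact_glFiniteIntegralLevel_holds 1 K with hh1
  obtain ⟨τ, hτW, hτW'⟩ := exists_automorphicRepData_detTwist_glOne h1 ψ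
  have hcusp : τ.W ≤ cuspFormsGL 1 K h1 := by
    rw [hτW, Submodule.span_le]
    rintro _ rfl
    exact IsCuspFormGL.mem_cuspFormsGL
      ⟨isAutomorphicForm_detTwist_glOne h1 ψ, fun k hk hk1 => absurd hk1 (by omega)⟩
  have hχτ := detTwist_datum_heckeCharacter (hcpt := h1) (θ := ψ) hτW
  obtain ⟨E, hE⟩ := τ.exists_hasArchParameter_glOne
  -- exponents `e` of `ω = π_ψ` (singletons everywhere: `K` is totally complex)
  have hsing : ∀ ι : K →+* ℂ, ∃ x : ℂ, E ι = {x} := by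
    intro ι
    have hw : (InfinitePlace.mk ι).IsComplex := NumberField.IsTotallyComplex.isComplex _
    obtain ⟨p, q, -, hp, hq, -⟩ :=
      archParam_embedding_sub_conj_mem_int_glOne τ hE ⟨InfinitePlace.mk ι, hw⟩
    have hp' : E (InfinitePlace.mk ι).embedding = {p} := hp
    have hq' : E (ComplexEmbedding.conjugate (InfinitePlace.mk ι).embedding) = {q} := hq
    rcases InfinitePlace.mk_eq_iff.mp (InfinitePlace.mk_embedding (InfinitePlace.mk ι)) with hι | hι
    · rw [hι] at hp'
      exact ⟨p, hp'⟩
    · rw [hι] at hq'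
      exact ⟨q, hq'⟩
  choose e he using hsing
  have hEe : E = fun ι => {e ι} := funext he
  have hcc : ∀ ι : K →+* ℂ, ComplexEmbedding.conjugate (ComplexEmbedding.conjugate ι) = ι :=
    fun ι => RingHom.ext fun x => by simp
  -- exact values of `e` at `σ_w`, `σ̄_w`: `± m_w / 2`
  have hex : ∀ w : {w : InfinitePlace K // w.IsComplex},
      e w.1.embedding = (if w.1 = w₁.1 then 1 / 2 else 0) ∧
        e (ComplexEmbedding.conjugate w.1.embedding) = (if w.1 = w₁.1 then -(1 / 2) else 0) := by
    intro w
    obtain ⟨-, hcx⟩ := archParam_of_hasUnitaryArchType τ hχτ hψ hE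
    obtain ⟨hp, hq⟩ := hcx w
    have e1 := Multiset.singleton_inj.1 ((he _).symm.trans hp)
    have e2 := Multiset.singleton_inj.1 ((he _).symm.trans hq)
    rw [e1, e2]
    constructor <;> split_ifs <;> push_cast <;> ring
  -- conjugate differences of `e` are integers
  have hez : ∀ ι : K →+* ℂ, ∃ n : ℤ, e ι - e (ComplexEmbedding.conjugate ι) = n := by
    intro ι
    have hw : (InfinitePlace.mk ι).IsComplex := NumberField.IsTotallyComplex.isComplex _
    obtain ⟨p, q, n, hp, hq, hn⟩ :=
      archParam_embedding_sub_conj_mem_int_glOne τ hE ⟨InfinitePlace.mk ι, hw⟩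
    have hp' : e (InfinitePlace.mk ι).embedding = p := Multiset.singleton_inj.1 ((he _).symm.trans hp)
    have hq' : e (ComplexEmbedding.conjugate (InfinitePlace.mk ι).embedding) = q :=
      Multiset.singleton_inj.1 ((he _).symm.trans hq)
    rcases InfinitePlace.mk_eq_iff.mp (InfinitePlace.mk_embedding (InfinitePlace.mk ι)) with hι | hι
    · rw [hι] at hp' hq'
      exact ⟨n, by rw [hp', hq', hn]⟩
    · have hι' : (InfinitePlace.mk ι).embedding = ComplexEmbedding.conjugate ι := by
        have h' := congrArg ComplexEmbedding.conjugate hι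
        rw [hcc] at h'
        exact h'
      rw [hι'] at hp'
      rw [hι', hcc] at hq'
      exact ⟨-n, by rw [hp', hq']; push_cast; linear_combination -hn⟩
  -- the place indicator `d = (1/4)·𝟙_{mk ι = w₁}` and the exponents `s₁ = e + d`, `s₂ = -d`
  set d : (K →+* ℂ) → ℂ := fun ι => if InfinitePlace.mk ι = w₁.1 then 1 / 4 else 0 with hd
  have hdconj : ∀ ι, d (ComplexEmbedding.conjugate ι) = d ι := fun ι => by
    simp only [hd, mk_conjugate_eq]
  set σ₁ : K →+* ℂ := w₁.1.embedding with hσ₁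
  set σ₂ : K →+* ℂ := w₂.1.embedding with hσ₂
  have hσ₁c : ComplexEmbedding.conjugate σ₁ ≠ σ₁ := fun h =>
    (not_isReal_iff_isComplex.mpr w₁.2) (isReal_iff.mpr (ComplexEmbedding.isReal_iff.mpr h))
  -- (i): `s₁ - s₂ = e + 2d ∈ {1, 0}`
  have hi : ∀ ι : K →+* ℂ, ∃ k : ℤ, (e ι + d ι) - (-d ι) = k := by
    intro ι
    have hw : (InfinitePlace.mk ι).IsComplex := NumberField.IsTotallyComplex.isComplex _
    obtain ⟨h₁, h₂⟩ := hex ⟨InfinitePlace.mk ι, hw⟩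
    by_cases hm : InfinitePlace.mk ι = w₁.1
    · rcases InfinitePlace.mk_eq_iff.mp (InfinitePlace.mk_embedding (InfinitePlace.mk ι)) with hι | hι
      · refine ⟨1, ?_⟩
        have : e ι = 1 / 2 := by rw [← hι]; simpa [hm] using h₁
        rw [this]; simp [hd, hm]; norm_num
      · refine ⟨0, ?_⟩
        have : e ι = -(1 / 2) := by rw [← hι]; simpa [hm] using h₂
        rw [this]; simp [hd, hm]; norm_num
    · rcases InfinitePlace.mk_eq_iff.mp (InfinitePlace.mk_embedding (InfinitePlace.mk ι)) with hι | hι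
      · refine ⟨0, ?_⟩
        have : e ι = 0 := by rw [← hι]; simpa [hm] using h₁
        rw [this]; simp [hd, hm]
      · refine ⟨0, ?_⟩
        have : e ι = 0 := by rw [← hι]; simpa [hm] using h₂
        rw [this]; simp [hd, hm]
  -- (ii): `s₁ ι - s₁ ῑ = e ι - e ῑ ∈ ℤ`
  have hii : ∀ ι : K →+* ℂ, ∃ m : ℤ, (e ι + d ι) - (e (ComplexEmbedding.conjugate ι) +
      d (ComplexEmbedding.conjugate ι)) = m := by
    intro ι
    obtain ⟨n, hn⟩ := hez ι
    exact ⟨n, by rw [hdconj]; linear_combination hn⟩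
  obtain ⟨χ, P, hP, hint⟩ := hC K hK h1 (fun ι => e ι + d ι) (fun ι => -d ι) hi hii
    ⟨⟨τ, hcusp⟩, by
      have : (fun ι : K →+* ℂ => ({(e ι + d ι) + -d ι} : Multiset ℂ)) = E := by
        rw [hEe]; funext ι; congr 1; ring
      rw [this]; exact hE⟩
  -- parallel real parts for `χ`
  obtain ⟨σ, -, hcplx⟩ := exists_re_archParam_parallel_glOne χ.1 hP
  have hPar : ∀ w : {w : InfinitePlace K // w.IsComplex},
      (P w.1.embedding + P (ComplexEmbedding.conjugate w.1.embedding)).re = 2 * σ :=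
    fun w => hcplx w _ _ rfl rfl
  -- values of `e` and `d` at `σ₁, σ̄₁, σ₂, σ̄₂`
  have hw₂ : w₂.1 ≠ w₁.1 := fun h => hne (Subtype.ext h).symm
  obtain ⟨e₁, e₁'⟩ := hex w₁
  obtain ⟨e₂, e₂'⟩ := hex w₂
  rw [if_pos rfl] at e₁ e₁'
  rw [if_neg hw₂] at e₂ e₂'
  have d₁ : d σ₁ = 1 / 4 := by simp [hd, hσ₁, mk_embedding]
  have d₁' : d (ComplexEmbedding.conjugate σ₁) = 1 / 4 := by rw [hdconj, d₁]
  have d₂ : d σ₂ = 0 := by simp [hd, hσ₂, mk_embedding, hw₂]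
  have d₂' : d (ComplexEmbedding.conjugate σ₂) = 0 := by rw [hdconj, d₂]
  obtain ⟨n₁, hn₁⟩ := hint σ₁
  obtain ⟨n₁', hn₁'⟩ := hint (ComplexEmbedding.conjugate σ₁)
  obtain ⟨n₂, hn₂⟩ := hint σ₂
  obtain ⟨n₂', hn₂'⟩ := hint (ComplexEmbedding.conjugate σ₂)
  rw [← hσ₁] at e₁ e₁'
  rw [← hσ₂] at e₂ e₂'
  rw [e₁, d₁] at hn₁
  rw [e₁', d₁'] at hn₁'
  rw [e₂, d₂] at hn₂
  rw [e₂', d₂'] at hn₂'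
  have p₁ := hPar w₁
  have p₂ := hPar w₂
  rw [← hσ₁] at p₁
  rw [← hσ₂] at p₂
  -- real parts
  have r₁ := congrArg Complex.re hn₁
  have r₁' := congrArg Complex.re hn₁'
  have r₂ := congrArg Complex.re hn₂
  have r₂' := congrArg Complex.re hn₂'
  simp only [Complex.add_re, Complex.sub_re, Complex.neg_re, Complex.zero_re, Complex.intCast_re]
    at r₁ r₁' r₂ r₂' p₁ p₂
  have q2 : ((1 : ℂ) / 2).re = 1 / 2 := by norm_num
  have q4 : ((1 : ℂ) / 4).re = 1 / 4 := by norm_num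
  simp only [q2, q4] at r₁ r₁' r₂ r₂'
  have key : (2 * ((n₁ + n₁') - (n₂ + n₂')) : ℝ) = 1 := by linarith
  have key' : (2 * ((n₁ + n₁') - (n₂ + n₂')) : ℤ) = 1 := by exact_mod_cast key
  omega

/-- `ℚ(ζ₅)` has two (complex) infinite places. [folklore] -/
theorem card_infinitePlace_K₅ : Fintype.card (InfinitePlace K₅) = 2 := by
  haveI := isCyclotomicExtension_K₅
  rw [card_eq_nrRealPlaces_add_nrComplexPlaces,
    IsCyclotomicExtension.Rat.nrRealPlaces_eq_zero (n := 5) K₅ (by decide), zero_add,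
    IsCyclotomicExtension.Rat.nrComplexPlaces_eq_totient_div_two (n := 5)]
  rfl

/-- **Hypothesis (iii) is load-bearing: the crux without this hypothesis is FALSE** (modulo Weil's
unit criterion; witness the CM quartic `ℚ(ζ₅)` with mixed parity at its two complex places). Together
with the positive analysis (uniform ODD parity is as good as uniform even parity) this pins the honest
form of (iii): uniform parity across the complex places. [cite: Patrikis2019, Lemma 2.1.1] -/
theorem halfIntegralTwistCM_false_without_parity (hW : Patrikis2019_heckeCharacter_archType_iff_units) :
    ¬ (∀ (K : Type) [Field K] [NumberField K], NumberField.IsCMField K →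
        ∀ (h1 : Literature.NumberTheory.Automorphic.isCompact_glFiniteIntegralLevel 1 K)
          (s₁ s₂ : (K →+* ℂ) → ℂ), (∀ ι, ∃ k : ℤ, s₁ ι - s₂ ι = k) →
          (∀ ι, ∃ m : ℤ, s₁ ι - s₁ (NumberField.ComplexEmbedding.conjugate ι) = m) →
          (∃ ω : Literature.NumberTheory.Automorphic.CuspidalAutomorphicRepData 1 K h1,
            ω.1.HasArchParameter (fun ι => {s₁ ι + s₂ ι})) →
          ∃ (χ : Literature.NumberTheory.Automorphic.CuspidalAutomorphicRepData 1 K h1)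
            (p : (K →+* ℂ) → ℂ), χ.1.HasArchParameter (fun ι => {p ι}) ∧
              ∀ ι, ∃ m : ℤ, p ι + s₁ ι - 1 / 2 = m) := by
  haveI : NumberField.IsCMField K₅ := isCMField_K₅
  have h : 1 < Fintype.card (InfinitePlace K₅) := by rw [card_infinitePlace_K₅]; decide
  obtain ⟨v₁, v₂, hne⟩ := Fintype.exists_pair_of_one_lt_card h
  exact halfIntegralTwistCM_false_without_parity_of_two_complex_places hW (K := K₅)
    ⟨v₁, NumberField.IsTotallyComplex.isComplex v₁⟩ ⟨v₂, NumberField.IsTotallyComplex.isComplex v₂⟩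
    (fun e => hne (congrArg Subtype.val e))

/-! ## Load-bearing analysis IV: hypothesis (iv) (automorphy of the given exponents) cannot be
## dropped (sorry-free, UNCONDITIONAL; witness `ℚ(ζ₅)`)

Without the datum `ω` the exponents `s₁, s₂` are free up to (i)–(iii), and nothing forces
`Re (s₁ σ_w + s₁ σ̄_w)` to be place-independent; but for the re-twist `χ` the quantity
`Re (p σ_w + p σ̄_w) ≡ 1 - Re (s₁ σ_w + s₁ σ̄_w) (mod ℤ)` must be (`exists_re_archParam_parallel_glOne`).
Witness over any CM field with two complex places: `s₁ = s₂ = (1/4 at σ_{w₁} and σ̄_{w₁}, 0 elsewhere)`. -/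

/-- **Hypothesis (iv) is load-bearing over every CM field with two complex places** (unconditional):
`s₁ = s₂ = (1/4)·𝟙_{mk ι = w₁}` satisfies (i)–(iii) and admits no half-integral re-twist, by the
parallelism of real parts for `χ`. [folklore] -/
theorem halfIntegralTwistCM_false_without_datum_of_two_complex_places
    {K : Type} [Field K] [NumberField K] [hK : NumberField.IsCMField K]
    (w₁ w₂ : {w : InfinitePlace K // w.IsComplex}) (hne : w₁ ≠ w₂) : ¬ (∀ (K : Type) [Field K] [NumberField K], NumberField.IsCMField K →
        ∀ (h1 : Literature.NumberTheory.Automorphic.isCompact_glFiniteIntegralLevel 1 K)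
          (s₁ s₂ : (K →+* ℂ) → ℂ), (∀ ι, ∃ k : ℤ, s₁ ι - s₂ ι = k) →
          (∀ ι, ∃ m : ℤ, s₁ ι - s₁ (NumberField.ComplexEmbedding.conjugate ι) = m) →
          (∀ ι, ∃ m : ℤ, (s₁ ι - s₂ ι) + (s₁ (NumberField.ComplexEmbedding.conjugate ι) -
            s₂ (NumberField.ComplexEmbedding.conjugate ι)) = 2 * m) →
          ∃ (χ : Literature.NumberTheory.Automorphic.CuspidalAutomorphicRepData 1 K h1)
            (p : (K →+* ℂ) → ℂ), χ.1.HasArchParameter (fun ι => {p ι}) ∧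
              ∀ ι, ∃ m : ℤ, p ι + s₁ ι - 1 / 2 = m) := by
  intro hC
  classical
  set h1 : isCompact_glFiniteIntegralLevel 1 K := isCompact_glFiniteIntegralLevel_holds 1 K with hh1
  set d : (K →+* ℂ) → ℂ := fun ι => if InfinitePlace.mk ι = w₁.1 then 1 / 4 else 0 with hd
  have hdconj : ∀ ι, d (ComplexEmbedding.conjugate ι) = d ι := fun ι => by
    simp only [hd, mk_conjugate_eq]
  obtain ⟨χ, P, hP, hint⟩ := hC K hK h1 d d (fun ι => ⟨0, by simp⟩)
    (fun ι => ⟨0, by rw [hdconj]; simp⟩) (fun ι => ⟨0, by simp⟩)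
  obtain ⟨σ, -, hcplx⟩ := exists_re_archParam_parallel_glOne χ.1 hP
  have hPar : ∀ w : {w : InfinitePlace K // w.IsComplex},
      (P w.1.embedding + P (ComplexEmbedding.conjugate w.1.embedding)).re = 2 * σ :=
    fun w => hcplx w _ _ rfl rfl
  set σ₁ : K →+* ℂ := w₁.1.embedding with hσ₁
  set σ₂ : K →+* ℂ := w₂.1.embedding with hσ₂
  have hw₂ : w₂.1 ≠ w₁.1 := fun h => hne (Subtype.ext h).symm
  have d₁ : d σ₁ = 1 / 4 := by simp [hd, hσ₁, mk_embedding]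
  have d₁' : d (ComplexEmbedding.conjugate σ₁) = 1 / 4 := by rw [hdconj, d₁]
  have d₂ : d σ₂ = 0 := by simp [hd, hσ₂, mk_embedding, hw₂]
  have d₂' : d (ComplexEmbedding.conjugate σ₂) = 0 := by rw [hdconj, d₂]
  obtain ⟨n₁, hn₁⟩ := hint σ₁
  obtain ⟨n₁', hn₁'⟩ := hint (ComplexEmbedding.conjugate σ₁)
  obtain ⟨n₂, hn₂⟩ := hint σ₂
  obtain ⟨n₂', hn₂'⟩ := hint (ComplexEmbedding.conjugate σ₂)
  rw [d₁] at hn₁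
  rw [d₁'] at hn₁'
  rw [d₂] at hn₂
  rw [d₂'] at hn₂'
  have p₁ := hPar w₁
  have p₂ := hPar w₂
  rw [← hσ₁] at p₁
  rw [← hσ₂] at p₂
  have r₁ := congrArg Complex.re hn₁
  have r₁' := congrArg Complex.re hn₁'
  have r₂ := congrArg Complex.re hn₂
  have r₂' := congrArg Complex.re hn₂'
  simp only [Complex.add_re, Complex.sub_re, Complex.zero_re, Complex.intCast_re] at r₁ r₁' r₂ r₂' p₁ p₂
  have q2 : ((1 : ℂ) / 2).re = 1 / 2 := by norm_num
  have q4 : ((1 : ℂ) / 4).re = 1 / 4 := by norm_num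
  simp only [q2, q4] at r₁ r₁' r₂ r₂'
  have key : (2 * ((n₁ + n₁') - (n₂ + n₂')) : ℝ) = 1 := by linarith
  have key' : (2 * ((n₁ + n₁') - (n₂ + n₂')) : ℤ) = 1 := by exact_mod_cast key
  omega

/-- **Hypothesis (iv) is load-bearing: the crux without this hypothesis is FALSE**, unconditionally
(witness `ℚ(ζ₅)`): the automorphy of the given exponents `s₁ + s₂` is what makes `Re (s₁ σ + s₁ σ̄)`
place-independent. [folklore] -/
theorem halfIntegralTwistCM_false_without_datum : ¬ (∀ (K : Type) [Field K] [NumberField K], NumberField.IsCMField K →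
        ∀ (h1 : Literature.NumberTheory.Automorphic.isCompact_glFiniteIntegralLevel 1 K)
          (s₁ s₂ : (K →+* ℂ) → ℂ), (∀ ι, ∃ k : ℤ, s₁ ι - s₂ ι = k) →
          (∀ ι, ∃ m : ℤ, s₁ ι - s₁ (NumberField.ComplexEmbedding.conjugate ι) = m) →
          (∀ ι, ∃ m : ℤ, (s₁ ι - s₂ ι) + (s₁ (NumberField.ComplexEmbedding.conjugate ι) -
            s₂ (NumberField.ComplexEmbedding.conjugate ι)) = 2 * m) →
          ∃ (χ : Literature.NumberTheory.Automorphic.CuspidalAutomorphicRepData 1 K h1)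
            (p : (K →+* ℂ) → ℂ), χ.1.HasArchParameter (fun ι => {p ι}) ∧
              ∀ ι, ∃ m : ℤ, p ι + s₁ ι - 1 / 2 = m) := by
  haveI : NumberField.IsCMField K₅ := isCMField_K₅
  have h : 1 < Fintype.card (InfinitePlace K₅) := by rw [card_infinitePlace_K₅]; decide
  obtain ⟨v₁, v₂, hne⟩ := Fintype.exists_pair_of_one_lt_card h
  exact halfIntegralTwistCM_false_without_datum_of_two_complex_places (K := K₅)
    ⟨v₁, NumberField.IsTotallyComplex.isComplex v₁⟩ ⟨v₂, NumberField.IsTotallyComplex.isComplex v₂⟩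
    (fun e => hne (congrArg Subtype.val e))

/-! ## Non-vacuity: the hypotheses of the crux are jointly satisfiable (sorry-free, unconditional)

Over `ℚ(ζ₅)`, `s₁ = s₂ = 0` with `ω = π_𝟙` (parameter `{0}`, `archParam_trivial_glOne`) satisfy (i)–(iv). -/

/-- **The hypotheses (i)–(iv) of the crux are satisfiable over a CM field** (`K = ℚ(ζ₅)`,
`s₁ = s₂ = 0`, `ω = π_𝟙`): no proof by `False.elim` on the hypotheses. [folklore] -/
theorem hypotheses_satisfiable :
    ∃ (K : Type) (_ : Field K) (_ : NumberField K) (_ : NumberField.IsCMField K)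
      (h1 : isCompact_glFiniteIntegralLevel 1 K) (s₁ s₂ : (K →+* ℂ) → ℂ),
      (∀ ι, ∃ k : ℤ, s₁ ι - s₂ ι = k) ∧
      (∀ ι, ∃ m : ℤ, s₁ ι - s₁ (NumberField.ComplexEmbedding.conjugate ι) = m) ∧
      (∀ ι, ∃ m : ℤ, (s₁ ι - s₂ ι) + (s₁ (NumberField.ComplexEmbedding.conjugate ι) -
        s₂ (NumberField.ComplexEmbedding.conjugate ι)) = 2 * m) ∧
      ∃ ω : CuspidalAutomorphicRepData 1 K h1, ω.1.HasArchParameter (fun ι => {s₁ ι + s₂ ι}) := by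
  classical
  set h1 : isCompact_glFiniteIntegralLevel 1 K₅ := isCompact_glFiniteIntegralLevel_holds 1 K₅ with hh1
  obtain ⟨τ, hτW, hτW'⟩ := exists_automorphicRepData_detTwist_glOne h1 (1 : HeckeCharacter K₅)
  have hcusp : τ.W ≤ cuspFormsGL 1 K₅ h1 := by
    rw [hτW, Submodule.span_le]
    rintro _ rfl
    exact IsCuspFormGL.mem_cuspFormsGL
      ⟨isAutomorphicForm_detTwist_glOne h1 (1 : HeckeCharacter K₅), fun k hk hk1 => absurd hk1 (by omega)⟩
  have hχτ := detTwist_datum_heckeCharacter (hcpt := h1) (θ := (1 : HeckeCharacter K₅)) hτW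
  obtain ⟨E, hE⟩ := τ.exists_hasArchParameter_glOne
  have hE0 : E = fun ι => ({(0 : ℂ) + 0} : Multiset ℂ) := by
    funext ι
    rw [add_zero]
    exact archParam_trivial_glOne τ hχτ hE ι
  refine ⟨K₅, inferInstance, inferInstance, isCMField_K₅, h1, fun _ => 0, fun _ => 0,
    fun _ => ⟨0, by simp⟩, fun _ => ⟨0, by simp⟩, fun _ => ⟨0, by simp⟩, ⟨τ, hcusp⟩, ?_⟩
  rw [← hE0]
  exact hE

end Summit.Langlands.Langlands.Theorems.HalfIntegralTwistCM.Negative
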